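import Summits.Ventures.HodgeRepro2.T5Sl2LowestWeight

/-!
# The standard `sl₂`-triple of `sl₂(K)`, its Cayley form, and the weights `3, 5, 7, …`

Tier-5 support (N4.3 = (R3), step (P2′); route/T5-SUPPORT-p1.md §S4).  `T5Sl2LowestWeight` works
with an abstract `IsSl2Triple (h, e, f)` spanning the Lie algebra; this file instantiates it:

* `h₀ = diag(1, −1)`, `e₀ = E₀₁`, `f₀ = E₁₀` in Mathlib's `LieAlgebra.SpecialLinear.sl (Fin 2) K`
  form an `sl₂`-triple (`isSl2Triple`) which SPANS `sl₂(K)` (`toLieSubalgebra_eq_top`) — so the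
  hypothesis `hL` of `T5Sl2LowestWeight` holds for every `sl₂(K)`-module;
* consequently, for an irreducible `sl₂(K)`-module with a lowest-weight vector of weight `3`
  (characteristic `0`), the `h₀`-eigenvalues are exactly `3, 5, 7, …`, each with multiplicity one
  (`hasEigenvalue_h₀_iff_of_three`, `finrank_eigenspace_h₀_eq_one_of_three`), and in general the
  eigenvalues of a lowest weight `μ ∉ −ℕ` are `μ, μ + 2, …` (`hasEigenvalue_h₀_iff`);
* the **Cayley form** over `ℂ`: with `W = !![0, 1; -1, 0]` (the generator of the rotation group
  `SO(2)`, `k(θ) = cos θ • 1 + sin θ • W` — `rotation_eq`), `C = !![1, -I; 1, I]` (the Cayley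
  matrix of `T5CayleySU11`) and Lang's operators `E₊ = ½ !![1, I; I, -1]`,
  `E₋ = ½ !![1, -I; -I, -1]` (`langEplus`, `langEminus`), one has `h₀ C = C (−I • W)`,
  `e₀ C = C E₊`, `f₀ C = C E₋` (`cayley_h₀`, `cayley_e₀`, `cayley_f₀`)
  and `(−I • W, E₊, E₋)` is itself an `sl₂`-triple in `sl₂(ℂ)` (`hCayley`, `eCayley`, `fCayley`,
  `isSl2Triple_cayley`): the `h₀`-eigenvalue of a vector is its eigenvalue for `−I • W`, i.e. the
  infinitesimal `SO(2)`-weight, in the coordinates of (P2′).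

What this file does NOT say: that `π₃⁺`'s `K`-finite vectors form such a module (printed, [C]);
nothing about the group `SU(1,1)` beyond the matrix identities above.

Blind lane: Mathlib + own prefix; no sorry; axioms ⊆ {propext, Classical.choice, Quot.sound}.
-/

namespace Summit.Ventures.HodgeRepro2.T5Sl2Standard

open LieAlgebra.SpecialLinear Matrix LieModule

section Triple

variable (K : Type*) [Field K]

/-- `h₀ = diag(1, −1) ∈ sl₂(K)`. -/
def h₀ : sl (Fin 2) K := singleSubSingle 0 1 1

/-- `e₀ = E₀₁ ∈ sl₂(K)`. -/
def e₀ : sl (Fin 2) K := single 0 1 (by decide) 1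

/-- `f₀ = E₁₀ ∈ sl₂(K)`. -/
def f₀ : sl (Fin 2) K := single 1 0 (by decide) 1

/-- The matrix of `h₀`. -/
lemma val_h₀ : (h₀ K).val = !![1, 0; 0, -1] := by
  ext i j
  fin_cases i <;> fin_cases j <;> simp [h₀]

/-- The matrix of `e₀`. -/
lemma val_e₀ : (e₀ K).val = !![0, 1; 0, 0] := by
  ext i j
  fin_cases i <;> fin_cases j <;> simp [e₀]

/-- The matrix of `f₀`. -/
lemma val_f₀ : (f₀ K).val = !![0, 0; 1, 0] := by
  ext i j
  fin_cases i <;> fin_cases j <;> simp [f₀]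

/-- `(h₀, e₀, f₀)` is an `sl₂`-triple. -/
theorem isSl2Triple : IsSl2Triple (h₀ K) (e₀ K) (f₀ K) where
  h_ne_zero := by
    intro h
    have := congrArg (fun x : sl (Fin 2) K => x.val 0 0) h
    simp [val_h₀] at this
  lie_e_f := by
    apply Subtype.ext
    rw [sl_bracket, val_e₀, val_f₀, val_h₀]
    ext i j
    fin_cases i <;> fin_cases j <;> simp
  lie_h_e_nsmul := by
    apply Subtype.ext
    rw [sl_bracket, AddSubmonoidClass.coe_nsmul, val_e₀, val_h₀]
    ext i j
    fin_cases i <;> fin_cases j <;> norm_num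
  lie_h_f_nsmul := by
    apply Subtype.ext
    rw [sl_bracket, NegMemClass.coe_neg, AddSubmonoidClass.coe_nsmul, val_f₀, val_h₀]
    ext i j
    fin_cases i <;> fin_cases j <;> norm_num

/-- Trace zero: the `(1, 1)` entry of an element of `sl₂(K)` is minus its `(0, 0)` entry. -/
lemma val_one_one (x : sl (Fin 2) K) : x.val 1 1 = -x.val 0 0 := by
  have h1 : x.val ∈ LinearMap.ker (Matrix.traceLinearMap (Fin 2) K K) := x.property
  rw [LinearMap.mem_ker, Matrix.traceLinearMap_apply, Matrix.trace_fin_two] at h1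
  linear_combination h1

/-- Every element of `sl₂(K)` is `x₀₁ • e₀ + x₁₀ • f₀ + x₀₀ • h₀` (trace zero). -/
lemma eq_smul_add (x : sl (Fin 2) K) :
    x = x.val 0 1 • e₀ K + x.val 1 0 • f₀ K + x.val 0 0 • h₀ K := by
  have htr : x.val 0 0 + x.val 1 1 = 0 := by rw [val_one_one]; ring
  apply Subtype.ext
  rw [AddMemClass.coe_add, AddMemClass.coe_add, SetLike.val_smul, SetLike.val_smul,
    SetLike.val_smul, val_e₀, val_f₀, val_h₀]
  ext i j
  fin_cases i <;> fin_cases j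
  · simp
  · simp
  · simp
  · simp
    linear_combination htr

/-- The standard triple spans `sl₂(K)`: the hypothesis `hL` of `T5Sl2LowestWeight`. -/
theorem toLieSubalgebra_eq_top : (isSl2Triple K).toLieSubalgebra K = ⊤ := by
  rw [eq_top_iff]
  intro x _
  rw [IsSl2Triple.mem_toLieSubalgebra_iff, (isSl2Triple K).lie_e_f]
  exact ⟨x.val 0 1, x.val 1 0, x.val 0 0, eq_smul_add K x⟩

end Triple

section Module

variable {K : Type*} [Field K] [CharZero K]
variable {M : Type*} [AddCommGroup M] [Module K M] [LieRingModule (sl (Fin 2) K) M]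
  [LieModule K (sl (Fin 2) K) M] [LieModule.IsIrreducible K (sl (Fin 2) K) M]

open T5Sl2LowestWeight

/-- In an irreducible `sl₂(K)`-module with a lowest-weight vector of weight `μ ∉ −ℕ`, the
`h₀`-eigenvalues are exactly `μ, μ + 2, μ + 4, …`. -/
theorem hasEigenvalue_h₀_iff {m : M} {μ : K} (P : HasLowestWeightVector (isSl2Triple K) m μ)
    (hμ : ∀ n : ℕ, μ ≠ -(n : K)) (c : K) :
    (toEnd K (sl (Fin 2) K) M (h₀ K)).HasEigenvalue c ↔ ∃ n : ℕ, c = μ + 2 * n :=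
  P.hasEigenvalue_iff hμ (toLieSubalgebra_eq_top K) c

/-- … each with multiplicity one. -/
theorem finrank_eigenspace_h₀_eq_one {m : M} {μ : K}
    (P : HasLowestWeightVector (isSl2Triple K) m μ) (hμ : ∀ n : ℕ, μ ≠ -(n : K)) (n : ℕ) :
    Module.finrank K ((toEnd K (sl (Fin 2) K) M (h₀ K)).eigenspace (μ + 2 * n)) = 1 :=
  P.finrank_eigenspace_eq_one hμ (toLieSubalgebra_eq_top K) n

/-- Lowest weight `3`: the `h₀`-eigenvalues of an irreducible `sl₂(K)`-module with a lowest-weight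
vector of weight `3` are exactly `3, 5, 7, …`. -/
theorem hasEigenvalue_h₀_iff_of_three {m : M}
    (P : HasLowestWeightVector (isSl2Triple K) m (3 : K))
    (c : K) : (toEnd K (sl (Fin 2) K) M (h₀ K)).HasEigenvalue c ↔ ∃ n : ℕ, c = 3 + 2 * n :=
  P.hasEigenvalue_iff_of_three (toLieSubalgebra_eq_top K) c

/-- Lowest weight `3`: each of `3, 5, 7, …` occurs exactly once. -/
theorem finrank_eigenspace_h₀_eq_one_of_three {m : M}
    (P : HasLowestWeightVector (isSl2Triple K) m (3 : K)) (n : ℕ) :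
    Module.finrank K ((toEnd K (sl (Fin 2) K) M (h₀ K)).eigenspace (3 + 2 * n)) = 1 :=
  P.finrank_eigenspace_eq_one_of_three (toLieSubalgebra_eq_top K) n

/-- Every `h₀`-eigenspace of an irreducible lowest-weight `sl₂(K)`-module has dimension `≤ 1`. -/
theorem finrank_eigenspace_h₀_le_one {m : M} {μ : K}
    (P : HasLowestWeightVector (isSl2Triple K) m μ) (c : K) :
    Module.finrank K ((toEnd K (sl (Fin 2) K) M (h₀ K)).eigenspace c) ≤ 1 :=
  P.finrank_eigenspace_le_one (toLieSubalgebra_eq_top K) c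

end Module

section Cayley

open Complex

/-- The generator `W = !![0, 1; -1, 0]` of the rotation group `SO(2)`. -/
def W : Matrix (Fin 2) (Fin 2) ℂ := !![0, 1; -1, 0]

/-- The rotation matrix `k(θ)` of (P2′). -/
noncomputable def rotation (θ : ℝ) : Matrix (Fin 2) (Fin 2) ℂ :=
  !![(Real.cos θ : ℂ), (Real.sin θ : ℂ); -(Real.sin θ : ℂ), (Real.cos θ : ℂ)]

/-- `k(θ) = cos θ • 1 + sin θ • W`. -/
lemma rotation_eq (θ : ℝ) : rotation θ = (Real.cos θ : ℂ) • 1 + (Real.sin θ : ℂ) • W := by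
  ext i j
  fin_cases i <;> fin_cases j <;> simp [rotation, W]

/-- The Cayley matrix `C = !![1, -I; 1, I]` of `T5CayleySU11`. -/
def cayley : Matrix (Fin 2) (Fin 2) ℂ := !![1, -I; 1, I]

/-- Lang's raising operator `E₊ = ½ !![1, I; I, -1]`. -/
noncomputable def langEplus : Matrix (Fin 2) (Fin 2) ℂ := (1 / 2 : ℂ) • !![1, I; I, -1]

/-- Lang's lowering operator `E₋ = ½ !![1, -I; -I, -1]`. -/
noncomputable def langEminus : Matrix (Fin 2) (Fin 2) ℂ := (1 / 2 : ℂ) • !![1, -I; -I, -1]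

/-- `h₀ · C = C · (−I • W)`: the Cayley transform carries the rotation generator (times `−I`) to
`h₀ = diag(1, −1)`. -/
lemma cayley_h₀ : (h₀ ℂ).val * cayley = cayley * (-(I • W)) := by
  rw [val_h₀]
  ext i j
  fin_cases i <;> fin_cases j <;> simp [cayley, W, Matrix.mul_apply, Fin.sum_univ_two]

/-- `e₀ · C = C · E₊`. -/
lemma cayley_e₀ : (e₀ ℂ).val * cayley = cayley * langEplus := by
  rw [val_e₀]
  ext i j
  fin_cases i <;> fin_cases j <;>
    simp [cayley, langEplus, Matrix.mul_apply, Fin.sum_univ_two, Complex.ext_iff] <;> norm_num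

/-- `f₀ · C = C · E₋`. -/
lemma cayley_f₀ : (f₀ ℂ).val * cayley = cayley * langEminus := by
  rw [val_f₀]
  ext i j
  fin_cases i <;> fin_cases j <;>
    simp [cayley, langEminus, Matrix.mul_apply, Fin.sum_univ_two, Complex.ext_iff] <;> norm_num

/-- Traceless `2 × 2` matrices are elements of `sl₂(ℂ)`. -/
lemma mem_sl_of_trace {A : Matrix (Fin 2) (Fin 2) ℂ} (h : A 0 0 + A 1 1 = 0) :
    A ∈ sl (Fin 2) ℂ := by
  show A ∈ LinearMap.ker (Matrix.traceLinearMap (Fin 2) ℂ ℂ)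
  rw [LinearMap.mem_ker, Matrix.traceLinearMap_apply, Matrix.trace_fin_two]
  exact h

/-- `−I • W` as an element of `sl₂(ℂ)`. -/
def hCayley : sl (Fin 2) ℂ := ⟨-(I • W), mem_sl_of_trace (by simp [W])⟩

/-- `E₊` as an element of `sl₂(ℂ)`. -/
noncomputable def eCayley : sl (Fin 2) ℂ :=
  ⟨langEplus, mem_sl_of_trace (by simp [langEplus])⟩

/-- `E₋` as an element of `sl₂(ℂ)`. -/
noncomputable def fCayley : sl (Fin 2) ℂ :=
  ⟨langEminus, mem_sl_of_trace (by simp [langEminus])⟩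

/-- `(−I • W, E₊, E₋)` is an `sl₂`-triple in `sl₂(ℂ)` — the standard triple in the coordinates of
`SL(2, ℝ)`: `−I • W` is the (complexified) rotation generator, `E₊` / `E₋` Lang's raising /
lowering operators. -/
theorem isSl2Triple_cayley : IsSl2Triple hCayley eCayley fCayley where
  h_ne_zero := by
    intro h
    have := congrArg (fun x : sl (Fin 2) ℂ => x.val 0 1) h
    simp [hCayley, W] at this
  lie_e_f := by
    apply Subtype.ext
    rw [sl_bracket]
    show langEplus * langEminus - langEminus * langEplus = -(I • W)
    ext i j
    fin_cases i <;> fin_cases j <;> simp [langEplus, langEminus, W, Complex.ext_iff] <;> norm_num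
  lie_h_e_nsmul := by
    apply Subtype.ext
    rw [sl_bracket, AddSubmonoidClass.coe_nsmul]
    show -(I • W) * langEplus - langEplus * -(I • W) = 2 • langEplus
    ext i j
    fin_cases i <;> fin_cases j <;> simp [langEplus, W, Complex.ext_iff] <;> norm_num
  lie_h_f_nsmul := by
    apply Subtype.ext
    rw [sl_bracket, NegMemClass.coe_neg, AddSubmonoidClass.coe_nsmul]
    show -(I • W) * langEminus - langEminus * -(I • W) = -(2 • langEminus)
    ext i j
    fin_cases i <;> fin_cases j <;> simp [langEminus, W, Complex.ext_iff] <;> norm_num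

end Cayley

end Summit.Ventures.HodgeRepro2.T5Sl2Standard
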